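import Summits.KontsevichZagierPeriods.KontsevichZagierPeriods.Theses.TerasomaMultiplication
import Summits.KontsevichZagierPeriods.KontsevichZagierPeriods.Theorems.CompleteModGammaSector.Negative.LoadBearing
import Summits.KontsevichZagierPeriods.KontsevichZagierPeriods.Theorems.FurushoPentagonReducedPeriodRingCubeMerge
import Literature.NumberTheory.Transcendental.KZCalculusProofs

/-!
# Leaf 3 `PiCancellationModGamma` — birth skeleton (cstrat-14233-r1)

`[π]`-cancellation MODULO Γ cut along its two ingredients: the ABSOLUTE `[π]`-cancellation
(item stmt-KontsevichZagierPeriods-0540 verbatim, shared by eight routes) and the Γ-SEPARATION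
(the Γ-part of a disc-certificate can be chosen disc-divisible: if `[disc × c] ∈ relations ⊔ closure Γ`
then `[disc × (c − γ)] ∈ relations` for some `γ ∈ closure Γ`). Composition kernel-checked. Neither stub
is the leaf: 0540 knows nothing of Γ, the separation produces no cancellation.
[Huber–Wüstholz 2022 App. A.4; Ayoub 2014 Conj. 7; Kontsevich–Zagier 2001 §4.1]
-/

noncomputable section
set_option linter.dupNamespace false

namespace Summit.KontsevichZagierPeriods.KontsevichZagierPeriods.Cruxes.CompleteModGammaSector.BirthPiCancellationModGamma

open MeasureTheory Set
open Literature.NumberTheory.Transcendental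
open Literature.NumberTheory.Transcendental.KZ hiding cubicalSpan

/-- Leaf 3 verbatim. -/
def PiCancellationModGamma : Prop :=
  ∀ (P : ∀ n : ℕ, Literature.NumberTheory.Transcendental.KZ.IntegralRep n → Literature.NumberTheory.Transcendental.KZ.IntegralRep (n + 2)), (∀ (n : ℕ) (r : Literature.NumberTheory.Transcendental.KZ.IntegralRep n), (P n r).domain = {z : Fin (n + 2) → ℝ | z 0 ^ 2 + z 1 ^ 2 ≤ 1 ∧ (fun i : Fin n => z i.succ.succ) ∈ r.domain} ∧ (P n r).integrand = fun z => r.integrand (fun i : Fin n => z i.succ.succ)) → ∀ c : Literature.NumberTheory.Transcendental.KZ.FormalRep, FreeAbelianGroup.lift (fun s : (Σ n, Literature.NumberTheory.Transcendental.KZ.IntegralRep n) => Literature.NumberTheory.Transcendental.KZ.of (P s.1 s.2)) c ∈ (Literature.NumberTheory.Transcendental.KZ.relations ⊔ AddSubgroup.closure {d : Literature.NumberTheory.Transcendental.KZ.FormalRep | ∃ (N N' k : ℕ) (x y : Fin N → ℚ) (x' y' : Fin N' → ℚ) (c : ℝ) (ρ : Literature.NumberTheory.Transcendental.KZ.IntegralRep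 N) (ρ' : Literature.NumberTheory.Transcendental.KZ.IntegralRep (2 * k + N')), (∀ j, 0 < x j ∧ 0 < y j ∧ Int.fract (x j) ≠ 0 ∧ Int.fract (y j) ≠ 0) ∧ (∀ l, 0 < x' l ∧ 0 < y' l ∧ Int.fract (x' l) ≠ 0 ∧ Int.fract (y' l) ≠ 0) ∧ (∀ u : ℕ, 0 < u → (∀ j, Nat.Coprime u (x j).den ∧ Nat.Coprime u (y j).den) → (∀ l, Nat.Coprime u (x' l).den ∧ Nat.Coprime u (y' l).den) → ((∑ j, (Int.fract ((u : ℚ) * x j) + Int.fract ((u : ℚ) * y j) - Int.fract ((u : ℚ) * (x j + y j)))) - ∑ l, (Int.fract ((u : ℚ) * x' l) + Int.fract ((u : ℚ) * y' l) - Int.fract ((u : ℚ) * (x' l + y' l)))) = (k : ℚ)) ∧ IsAlgebraic ℚ c ∧ ρ.domain = {t | ∀ j, t j ∈ Set.Ioo (0:ℝ) 1} ∧ Set.EqOn ρ.integrand (fun t => ∏ j, (t j) ^ ((x j : ℝ) - 1) * (1 - t j) ^ ((y j : ℝ) - 1)) ρ.domain ∧ ρ'.domain = {z | (∑ i : Fin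 (2 * k), (z (Fin.castAdd N' i)) ^ 2) < 1 ∧ ∀ l : Fin N', z (Fin.natAdd (2 * k) l) ∈ Set.Ioo (0:ℝ) 1} ∧ Set.EqOn ρ'.integrand (fun z => c * (k.factorial : ℝ) * ∏ l, (z (Fin.natAdd (2 * k) l)) ^ ((x' l : ℝ) - 1) * (1 - z (Fin.natAdd (2 * k) l)) ^ ((y' l : ℝ) - 1)) ρ'.domain ∧ ρ.value = ρ'.value ∧ d = Literature.NumberTheory.Transcendental.KZ.of ρ - Literature.NumberTheory.Transcendental.KZ.of ρ'}) → c ∈ (Literature.NumberTheory.Transcendental.KZ.relations ⊔ AddSubgroup.closure {d : Literature.NumberTheory.Transcendental.KZ.FormalRep | ∃ (N N' k : ℕ) (x y : Fin N → ℚ) (x' y' : Fin N' → ℚ) (c : ℝ) (ρ : Literature.NumberTheory.Transcendental.KZ.IntegralRep N) (ρ' : Literature.NumberTheory.Transcendental.KZ.IntegralRep (2 * k + N')), (∀ j, 0 < x j ∧ 0 < y j ∧ Int.fract (x j) ≠ 0 ∧ Int.fract (y j) ≠ 0) ∧ (∀ l, 0 < x' l ∧ 0 < y' l ∧ Int.fract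 (x' l) ≠ 0 ∧ Int.fract (y' l) ≠ 0) ∧ (∀ u : ℕ, 0 < u → (∀ j, Nat.Coprime u (x j).den ∧ Nat.Coprime u (y j).den) → (∀ l, Nat.Coprime u (x' l).den ∧ Nat.Coprime u (y' l).den) → ((∑ j, (Int.fract ((u : ℚ) * x j) + Int.fract ((u : ℚ) * y j) - Int.fract ((u : ℚ) * (x j + y j)))) - ∑ l, (Int.fract ((u : ℚ) * x' l) + Int.fract ((u : ℚ) * y' l) - Int.fract ((u : ℚ) * (x' l + y' l)))) = (k : ℚ)) ∧ IsAlgebraic ℚ c ∧ ρ.domain = {t | ∀ j, t j ∈ Set.Ioo (0:ℝ) 1} ∧ Set.EqOn ρ.integrand (fun t => ∏ j, (t j) ^ ((x j : ℝ) - 1) * (1 - t j) ^ ((y j : ℝ) - 1)) ρ.domain ∧ ρ'.domain = {z | (∑ i : Fin (2 * k), (z (Fin.castAdd N' i)) ^ 2) < 1 ∧ ∀ l : Fin N', z (Fin.natAdd (2 * k) l) ∈ Set.Ioo (0:ℝ) 1} ∧ Set.EqOn ρ'.integrand (fun z => c * (k.factorial : ℝ) * ∏ l, (z (Fin.natAdd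 (2 * k) l)) ^ ((x' l : ℝ) - 1) * (1 - z (Fin.natAdd (2 * k) l)) ^ ((y' l : ℝ) - 1)) ρ'.domain ∧ ρ.value = ρ'.value ∧ d = Literature.NumberTheory.Transcendental.KZ.of ρ - Literature.NumberTheory.Transcendental.KZ.of ρ'})

/-- **Stub 1 (Γ-separation).** If a disc multiple of `c` is Γ-accessible, then for some `γ` in the
Γ-span the disc multiple of `c − γ` is an honest KZ relation. Crux-implied (given the pinned left-ideal
property); isolates exactly the interaction of the disc factor with the Γ-Hodge pairs.
[cite: KontsevichZagier2001, §4.1] -/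
theorem stub_gammaSeparation : ∀ (P : ∀ n : ℕ, Literature.NumberTheory.Transcendental.KZ.IntegralRep n → Literature.NumberTheory.Transcendental.KZ.IntegralRep (n + 2)), (∀ (n : ℕ) (r : Literature.NumberTheory.Transcendental.KZ.IntegralRep n), (P n r).domain = {z : Fin (n + 2) → ℝ | z 0 ^ 2 + z 1 ^ 2 ≤ 1 ∧ (fun i : Fin n => z i.succ.succ) ∈ r.domain} ∧ (P n r).integrand = fun z => r.integrand (fun i : Fin n => z i.succ.succ)) → ∀ c : Literature.NumberTheory.Transcendental.KZ.FormalRep, FreeAbelianGroup.lift (fun s : (Σ n, Literature.NumberTheory.Transcendental.KZ.IntegralRep n) => Literature.NumberTheory.Transcendental.KZ.of (P s.1 s.2)) c ∈ (Literature.NumberTheory.Transcendental.KZ.relations ⊔ AddSubgroup.closure {d : Literature.NumberTheory.Transcendental.KZ.FormalRep | ∃ (N N' k : ℕ) (x y : Fin N → ℚ) (x' y' : Fin N' → ℚ) (c : ℝ) (ρ : Literature.NumberTheory.Transcendental.KZ.IntegralRep N) (ρ' : Literature.NumberTheory.Transcendental.KZ.IntegralRep (2 * k + N')), (∀ j, 0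 < x j ∧ 0 < y j ∧ Int.fract (x j) ≠ 0 ∧ Int.fract (y j) ≠ 0) ∧ (∀ l, 0 < x' l ∧ 0 < y' l ∧ Int.fract (x' l) ≠ 0 ∧ Int.fract (y' l) ≠ 0) ∧ (∀ u : ℕ, 0 < u → (∀ j, Nat.Coprime u (x j).den ∧ Nat.Coprime u (y j).den) → (∀ l, Nat.Coprime u (x' l).den ∧ Nat.Coprime u (y' l).den) → ((∑ j, (Int.fract ((u : ℚ) * x j) + Int.fract ((u : ℚ) * y j) - Int.fract ((u : ℚ) * (x j + y j)))) - ∑ l, (Int.fract ((u : ℚ) * x' l) + Int.fract ((u : ℚ) * y' l) - Int.fract ((u : ℚ) * (x' l + y' l)))) = (k : ℚ)) ∧ IsAlgebraic ℚ c ∧ ρ.domain = {t | ∀ j, t j ∈ Set.Ioo (0:ℝ) 1} ∧ Set.EqOn ρ.integrand (fun t => ∏ j, (t j) ^ ((x j : ℝ) - 1) * (1 - t j) ^ ((y j : ℝ) - 1)) ρ.domain ∧ ρ'.domain = {z | (∑ i : Fin (2 * k), (z (Fin.castAdd N' i)) ^ 2) < 1 ∧ ∀ l : Fin N', z (Fin.natAdd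 (2 * k) l) ∈ Set.Ioo (0:ℝ) 1} ∧ Set.EqOn ρ'.integrand (fun z => c * (k.factorial : ℝ) * ∏ l, (z (Fin.natAdd (2 * k) l)) ^ ((x' l : ℝ) - 1) * (1 - z (Fin.natAdd (2 * k) l)) ^ ((y' l : ℝ) - 1)) ρ'.domain ∧ ρ.value = ρ'.value ∧ d = Literature.NumberTheory.Transcendental.KZ.of ρ - Literature.NumberTheory.Transcendental.KZ.of ρ'}) → ∃ γ ∈ AddSubgroup.closure {d : Literature.NumberTheory.Transcendental.KZ.FormalRep | ∃ (N N' k : ℕ) (x y : Fin N → ℚ) (x' y' : Fin N' → ℚ) (c : ℝ) (ρ : Literature.NumberTheory.Transcendental.KZ.IntegralRep N) (ρ' : Literature.NumberTheory.Transcendental.KZ.IntegralRep (2 * k + N')), (∀ j, 0 < x j ∧ 0 < y j ∧ Int.fract (x j) ≠ 0 ∧ Int.fract (y j) ≠ 0) ∧ (∀ l, 0 < x' l ∧ 0 < y' l ∧ Int.fract (x' l) ≠ 0 ∧ Int.fract (y' l) ≠ 0) ∧ (∀ u : ℕ, 0 < u → (∀ j, Nat.Coprime u (x j).den ∧ Nat.Coprime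 u (y j).den) → (∀ l, Nat.Coprime u (x' l).den ∧ Nat.Coprime u (y' l).den) → ((∑ j, (Int.fract ((u : ℚ) * x j) + Int.fract ((u : ℚ) * y j) - Int.fract ((u : ℚ) * (x j + y j)))) - ∑ l, (Int.fract ((u : ℚ) * x' l) + Int.fract ((u : ℚ) * y' l) - Int.fract ((u : ℚ) * (x' l + y' l)))) = (k : ℚ)) ∧ IsAlgebraic ℚ c ∧ ρ.domain = {t | ∀ j, t j ∈ Set.Ioo (0:ℝ) 1} ∧ Set.EqOn ρ.integrand (fun t => ∏ j, (t j) ^ ((x j : ℝ) - 1) * (1 - t j) ^ ((y j : ℝ) - 1)) ρ.domain ∧ ρ'.domain = {z | (∑ i : Fin (2 * k), (z (Fin.castAdd N' i)) ^ 2) < 1 ∧ ∀ l : Fin N', z (Fin.natAdd (2 * k) l) ∈ Set.Ioo (0:ℝ) 1} ∧ Set.EqOn ρ'.integrand (fun z => c * (k.factorial : ℝ) * ∏ l, (z (Fin.natAdd (2 * k) l)) ^ ((x' l : ℝ) - 1) * (1 - z (Fin.natAdd (2 * k) l)) ^ ((y' l : ℝ) - 1)) ρ'.domain ∧ ρ.value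 = ρ'.value ∧ d = Literature.NumberTheory.Transcendental.KZ.of ρ - Literature.NumberTheory.Transcendental.KZ.of ρ'}, FreeAbelianGroup.lift (fun s : (Σ n, Literature.NumberTheory.Transcendental.KZ.IntegralRep n) => Literature.NumberTheory.Transcendental.KZ.of (P s.1 s.2)) (c - γ) ∈ Literature.NumberTheory.Transcendental.KZ.relations := by
  sorry

/-- **Stub 2 = item stmt-KontsevichZagierPeriods-0540 (`AyoubPiCancellation`) VERBATIM.**
[cite: HuberWustholz2022, App. A.4] -/
theorem stub_piCancellation : ∀ (P : ∀ n : ℕ, Literature.NumberTheory.Transcendental.KZ.IntegralRep n → Literature.NumberTheory.Transcendental.KZ.IntegralRep (n + 2)), (∀ (n : ℕ) (r : Literature.NumberTheory.Transcendental.KZ.IntegralRep n), (P n r).domain = {z : Fin (n + 2) → ℝ | z 0 ^ 2 + z 1 ^ 2 ≤ 1 ∧ (fun i : Fin n => z i.succ.succ) ∈ r.domain} ∧ (P n r).integrand = fun z => r.integrand (fun i : Fin n => z i.succ.succ)) → ∀ c : Literature.NumberTheory.Transcendental.KZ.FormalRep, FreeAbelianGroup.lift (fun s : (Σ n, Literature.NumberTheory.Transcendental.KZ.IntegralRep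 n) => Literature.NumberTheory.Transcendental.KZ.of (P s.1 s.2)) c ∈ Literature.NumberTheory.Transcendental.KZ.relations → c ∈ Literature.NumberTheory.Transcendental.KZ.relations := by
  sorry

/-- **Composition** (kernel-checked). [folklore] -/
theorem PiCancellationModGamma_of
    (h1 : ∀ (P : ∀ n : ℕ, Literature.NumberTheory.Transcendental.KZ.IntegralRep n → Literature.NumberTheory.Transcendental.KZ.IntegralRep (n + 2)), (∀ (n : ℕ) (r : Literature.NumberTheory.Transcendental.KZ.IntegralRep n), (P n r).domain = {z : Fin (n + 2) → ℝ | z 0 ^ 2 + z 1 ^ 2 ≤ 1 ∧ (fun i : Fin n => z i.succ.succ) ∈ r.domain} ∧ (P n r).integrand = fun z => r.integrand (fun i : Fin n => z i.succ.succ)) → ∀ c : Literature.NumberTheory.Transcendental.KZ.FormalRep, FreeAbelianGroup.lift (fun s : (Σ n, Literature.NumberTheory.Transcendental.KZ.IntegralRep n) => Literature.NumberTheory.Transcendental.KZ.of (P s.1 s.2)) c ∈ (Literature.NumberTheory.Transcendental.KZ.relations ⊔ AddSubgroup.closure {d : Literature.NumberTheory.Transcendental.KZ.FormalRep | ∃ (N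 N' k : ℕ) (x y : Fin N → ℚ) (x' y' : Fin N' → ℚ) (c : ℝ) (ρ : Literature.NumberTheory.Transcendental.KZ.IntegralRep N) (ρ' : Literature.NumberTheory.Transcendental.KZ.IntegralRep (2 * k + N')), (∀ j, 0 < x j ∧ 0 < y j ∧ Int.fract (x j) ≠ 0 ∧ Int.fract (y j) ≠ 0) ∧ (∀ l, 0 < x' l ∧ 0 < y' l ∧ Int.fract (x' l) ≠ 0 ∧ Int.fract (y' l) ≠ 0) ∧ (∀ u : ℕ, 0 < u → (∀ j, Nat.Coprime u (x j).den ∧ Nat.Coprime u (y j).den) → (∀ l, Nat.Coprime u (x' l).den ∧ Nat.Coprime u (y' l).den) → ((∑ j, (Int.fract ((u : ℚ) * x j) + Int.fract ((u : ℚ) * y j) - Int.fract ((u : ℚ) * (x j + y j)))) - ∑ l, (Int.fract ((u : ℚ) * x' l) + Int.fract ((u : ℚ) * y' l) - Int.fract ((u : ℚ) * (x' l + y' l)))) = (k : ℚ)) ∧ IsAlgebraic ℚ c ∧ ρ.domain = {t | ∀ j, t j ∈ Set.Ioo (0:ℝ) 1} ∧ Set.EqOn ρ.integrand (fun t => ∏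 j, (t j) ^ ((x j : ℝ) - 1) * (1 - t j) ^ ((y j : ℝ) - 1)) ρ.domain ∧ ρ'.domain = {z | (∑ i : Fin (2 * k), (z (Fin.castAdd N' i)) ^ 2) < 1 ∧ ∀ l : Fin N', z (Fin.natAdd (2 * k) l) ∈ Set.Ioo (0:ℝ) 1} ∧ Set.EqOn ρ'.integrand (fun z => c * (k.factorial : ℝ) * ∏ l, (z (Fin.natAdd (2 * k) l)) ^ ((x' l : ℝ) - 1) * (1 - z (Fin.natAdd (2 * k) l)) ^ ((y' l : ℝ) - 1)) ρ'.domain ∧ ρ.value = ρ'.value ∧ d = Literature.NumberTheory.Transcendental.KZ.of ρ - Literature.NumberTheory.Transcendental.KZ.of ρ'}) → ∃ γ ∈ AddSubgroup.closure {d : Literature.NumberTheory.Transcendental.KZ.FormalRep | ∃ (N N' k : ℕ) (x y : Fin N → ℚ) (x' y' : Fin N' → ℚ) (c : ℝ) (ρ : Literature.NumberTheory.Transcendental.KZ.IntegralRep N) (ρ' : Literature.NumberTheory.Transcendental.KZ.IntegralRep (2 * k + N')), (∀ j, 0 < x j ∧ 0 < y j ∧ Int.fract (x j) ≠ 0 ∧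 Int.fract (y j) ≠ 0) ∧ (∀ l, 0 < x' l ∧ 0 < y' l ∧ Int.fract (x' l) ≠ 0 ∧ Int.fract (y' l) ≠ 0) ∧ (∀ u : ℕ, 0 < u → (∀ j, Nat.Coprime u (x j).den ∧ Nat.Coprime u (y j).den) → (∀ l, Nat.Coprime u (x' l).den ∧ Nat.Coprime u (y' l).den) → ((∑ j, (Int.fract ((u : ℚ) * x j) + Int.fract ((u : ℚ) * y j) - Int.fract ((u : ℚ) * (x j + y j)))) - ∑ l, (Int.fract ((u : ℚ) * x' l) + Int.fract ((u : ℚ) * y' l) - Int.fract ((u : ℚ) * (x' l + y' l)))) = (k : ℚ)) ∧ IsAlgebraic ℚ c ∧ ρ.domain = {t | ∀ j, t j ∈ Set.Ioo (0:ℝ) 1} ∧ Set.EqOn ρ.integrand (fun t => ∏ j, (t j) ^ ((x j : ℝ) - 1) * (1 - t j) ^ ((y j : ℝ) - 1)) ρ.domain ∧ ρ'.domain = {z | (∑ i : Fin (2 * k), (z (Fin.castAdd N' i)) ^ 2) < 1 ∧ ∀ l : Fin N', z (Fin.natAdd (2 * k) l) ∈ Set.Ioo (0:ℝ) 1} ∧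 Set.EqOn ρ'.integrand (fun z => c * (k.factorial : ℝ) * ∏ l, (z (Fin.natAdd (2 * k) l)) ^ ((x' l : ℝ) - 1) * (1 - z (Fin.natAdd (2 * k) l)) ^ ((y' l : ℝ) - 1)) ρ'.domain ∧ ρ.value = ρ'.value ∧ d = Literature.NumberTheory.Transcendental.KZ.of ρ - Literature.NumberTheory.Transcendental.KZ.of ρ'}, FreeAbelianGroup.lift (fun s : (Σ n, Literature.NumberTheory.Transcendental.KZ.IntegralRep n) => Literature.NumberTheory.Transcendental.KZ.of (P s.1 s.2)) (c - γ) ∈ Literature.NumberTheory.Transcendental.KZ.relations)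
    (h2 : ∀ (P : ∀ n : ℕ, Literature.NumberTheory.Transcendental.KZ.IntegralRep n → Literature.NumberTheory.Transcendental.KZ.IntegralRep (n + 2)), (∀ (n : ℕ) (r : Literature.NumberTheory.Transcendental.KZ.IntegralRep n), (P n r).domain = {z : Fin (n + 2) → ℝ | z 0 ^ 2 + z 1 ^ 2 ≤ 1 ∧ (fun i : Fin n => z i.succ.succ) ∈ r.domain} ∧ (P n r).integrand = fun z => r.integrand (fun i : Fin n => z i.succ.succ)) → ∀ c : Literature.NumberTheory.Transcendental.KZ.FormalRep, FreeAbelianGroup.lift (fun s : (Σ n, Literature.NumberTheory.Transcendental.KZ.IntegralRep n) => Literature.NumberTheory.Transcendental.KZ.of (P s.1 s.2)) c ∈ Literature.NumberTheory.Transcendental.KZ.relations → c ∈ Literature.NumberTheory.Transcendental.KZ.relations) :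
    PiCancellationModGamma := by
  intro P hP c hc
  obtain ⟨γ, hγ, hsep⟩ := h1 P hP c hc
  have hcγ : c - γ ∈ relations := h2 P hP (c - γ) hsep
  have : c = (c - γ) + γ := by abel
  rw [this]
  exact AddSubgroup.add_mem _ (AddSubgroup.mem_sup_left hcγ) (AddSubgroup.mem_sup_right hγ)

/-- The leaf from the registered stubs. -/
theorem piCancellationModGamma_of_stubs : PiCancellationModGamma :=
  PiCancellationModGamma_of stub_gammaSeparation stub_piCancellation

end Summit.KontsevichZagierPeriods.KontsevichZagierPeriods.Cruxes.CompleteModGammaSector.BirthPiCancellationModGamma
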